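import Summits.Langlands.Langlands.Theorems.IrreducibilityBySelfDualityHeckeEigenvalueFieldStubSandwichIn
import Mathlib.Analysis.Matrix.Hermitian
import Mathlib.Analysis.Normed.Ring.Units
import Mathlib.Topology.Instances.Matrix
import HarnessLib

/-!
# Reduced families lie in a Siegel domain — lemmas (stub `stub_sandwich_out`, part 1)

Crux `HeckeEigenvalueField` (stmt-Langlands-13632), line `Sketch`.  Helper file for the registered
stub `stub_sandwich_out` (the inclusion `R(c, C, τ) ⊆ 𝔖' • 1` of the `(c, C, τ)`-reduced matrices
over `mixedSpace K` in an archimedean Siegel DOMAIN, [Borel1969, §1, §12–§13]):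

1. **Recursive Cholesky decomposition with bounds** (`sandOut_cholesky`): a `(c, C, τ)`-reduced
   family `H = (H_w)` of `m × m` complex matrices (`SiegelFamily.IsReduced`) is `H_w = u_w Λ_w u_wᴴ`
   with `u_w` unipotent upper triangular with off-diagonal entries of norm `< c`, and
   `Λ_w = diag(λ_{w,k})` positive with `λ_{w,k} < C λ_{w',k}` and `λ_{w,k+1} < τ λ_{w,k}`; real
   matrices have real Cholesky factors.  Induction on `m`, peeling the last index:
   `H = [[S + a x xᴴ, a x], [a xᴴ, a]] = U_x · diag(S, a) · U_xᴴ`, `S` the Schur complement.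
2. **A compact archimedean piece of the Borel subgroup** (`sandOut_exists_Omega`): the elements of
   `GL_n(K ⊗ ℝ)` with bounded upper triangular matrix and diagonal entries with real parts bounded
   below, re-embedded in `GL_n(𝔸_K)` with trivial finite part, form a compact subset of `B(𝔸_K)`
   (`GL_n(K ⊗ ℝ) → M_n(K ⊗ ℝ)` is a topological embedding since inversion is continuous on the
   units of the complete normed ring `K ⊗ ℝ`).

The descent from the Cholesky coordinates to a Siegel-set point is in the sequel file
(`…StubSandwichOut`).

## References

* A. Borel, *Introduction aux groupes arithmétiques*, Hermann (1969), §1, §12–§13 [Borel1969].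
-/

noncomputable section

set_option linter.dupNamespace false -- project-wide: `Summit.Langlands.Langlands` is the mandated namespace

open scoped Pointwise NNReal MatrixGroups ComplexOrder Matrix ComplexConjugate
open NumberField NumberField.mixedEmbedding IsDedekindDomain Literature.NumberTheory.Automorphic

namespace Summit.Langlands.Langlands.Theorems.HeckeEigenvalueField.Res

/-! ### 1. Recursive Cholesky decomposition with bounds -/

section Cholesky

/-- The Schur complement of a matrix with real entries has real entries. [folklore] -/
theorem sandOut_conj_schur {ι : Type*} {m : ℕ} (H : ι → Matrix (Fin (m + 1)) (Fin (m + 1)) ℂ)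
    {w : ι} (h : ∀ i j, conj (H w i j) = H w i j) (i j : Fin m) :
    conj (SiegelFamily.schur H w i j) = SiegelFamily.schur H w i j := by
  simp only [SiegelFamily.schur_apply, map_sub, map_mul, map_div₀, h]

/-- **Recursive Cholesky decomposition of a reduced family, with bounds**: a `(c, C, τ)`-reduced
family `H = (H_w)_{w ∈ ι}` of `m × m` complex matrices is `H_w = u_w · diag(λ_{w,·}) · u_wᴴ` with
`u_w` unipotent upper triangular, `‖u_w[i,j]‖ < c` above the diagonal, `λ_{w,k} > 0`,
`λ_{w,k} < C λ_{w',k}` and `λ_{w,k+1} < τ λ_{w,k}`; on a set of indices `p` where the `H_w` are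
real, the `u_w` are real.  (Peel the last index `l`: `a = H[l,l]`, `x = H[<l, l] / a`,
`H = [[S + a x xᴴ, a x], [a xᴴ, a]]` with `S` the Schur complement, so `u = [[u', x], [0, 1]]`,
`λ = (λ', a)` for the decomposition `S = u' diag(λ') u'ᴴ` given by induction.)
[cite: Borel1969, §1, §12–§13] -/
theorem sandOut_cholesky {ι : Type*} (c C τ : ℝ) (p : ι → Prop) (m : ℕ) :
    ∀ (H : ι → Matrix (Fin m) (Fin m) ℂ), SiegelFamily.IsReduced c C τ m H →
      (∀ w, p w → ∀ i j, conj (H w i j) = H w i j) →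
      ∃ (u : ι → Matrix (Fin m) (Fin m) ℂ) (d : ι → Fin m → ℝ),
        (∀ w i, u w i i = 1) ∧ (∀ w i j, j < i → u w i j = 0) ∧
        (∀ w i j, i < j → ‖u w i j‖ < c) ∧ (∀ w, p w → ∀ i j, conj (u w i j) = u w i j) ∧
        (∀ w k, 0 < d w k) ∧ (∀ w w' k, d w k < C * d w' k) ∧
        (∀ w (i j : Fin m), (i : ℕ) + 1 = j → d w j < τ * d w i) ∧
        ∀ w, H w = u w * Matrix.diagonal (fun k => (d w k : ℂ)) * (u w)ᴴ := by
  induction m with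
  | zero =>
    intro _ _ _
    exact ⟨fun _ => 1, fun _ _ => 1, fun _ i => Fin.elim0 i, fun _ i => Fin.elim0 i,
      fun _ i => Fin.elim0 i, fun _ _ i => Fin.elim0 i, fun _ k => Fin.elim0 k,
      fun _ _ k => Fin.elim0 k, fun _ i => Fin.elim0 i, fun _ => Matrix.ext fun i => Fin.elim0 i⟩
  | succ m ih =>
    intro H hH hreal
    obtain ⟨hh, hpos, hcross, hcol, hratio, hsch⟩ := hH
    obtain ⟨u', d', hu'1, hu'0, hu'c, hu'r, hd'pos, hd'cross, hd'ratio, hS⟩ :=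
      ih (SiegelFamily.schur H) hsch fun w hw i j => sandOut_conj_schur H (hreal w hw) i j
    -- the pivot `a_w = H_w[l,l]`, real and positive, and the column ratios `x_w = H_w[<l, l] / a_w`
    set a : ι → ℝ := fun w => (H w (Fin.last m) (Fin.last m)).re with ha_def
    have ha : ∀ w, H w (Fin.last m) (Fin.last m) = (a w : ℂ) := fun w => by
      have h := (hh w).coe_re_apply_self (Fin.last m)
      simpa using h.symm
    have hapos : ∀ w, 0 < a w := hpos
    have hstar_a : ∀ w, star (a w : ℂ) = a w := fun w => Complex.conj_ofReal _
    set x : ι → Fin m → ℂ := fun w j => H w j.castSucc (Fin.last m) / H w (Fin.last m) (Fin.last m)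
      with hx_def
    -- the new factors
    set u : ι → Matrix (Fin (m + 1)) (Fin (m + 1)) ℂ := fun w => Matrix.of fun i j =>
      Fin.snoc (α := fun _ => ℂ)
        (fun j₀ : Fin m => Fin.snoc (α := fun _ => ℂ) (fun i₀ : Fin m => u' w i₀ j₀) 0 i)
        (Fin.snoc (α := fun _ => ℂ) (x w) 1 i) j with hu_def
    set d : ι → Fin (m + 1) → ℝ := fun w => Fin.snoc (α := fun _ => ℝ) (d' w) (a w) with hd_def
    have hu_cc : ∀ w (i₀ j₀ : Fin m), u w i₀.castSucc j₀.castSucc = u' w i₀ j₀ := fun w i₀ j₀ => by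
      simp [hu_def]
    have hu_lc : ∀ w (j₀ : Fin m), u w (Fin.last m) j₀.castSucc = 0 := fun w j₀ => by simp [hu_def]
    have hu_cl : ∀ w (i₀ : Fin m), u w i₀.castSucc (Fin.last m) = x w i₀ := fun w i₀ => by
      simp [hu_def]
    have hu_ll : ∀ w, u w (Fin.last m) (Fin.last m) = 1 := fun w => by simp [hu_def]
    have hd_c : ∀ w (k₀ : Fin m), d w k₀.castSucc = d' w k₀ := fun w k₀ => by simp [hd_def]
    have hd_l : ∀ w, d w (Fin.last m) = a w := fun w => by simp [hd_def]
    -- the entries of `u' diag(λ') u'ᴴ = schur H`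
    have hSe : ∀ w (i₀ j₀ : Fin m),
        ∑ k₀, u' w i₀ k₀ * (d' w k₀ : ℂ) * star (u' w j₀ k₀) = SiegelFamily.schur H w i₀ j₀ := by
      intro w i₀ j₀
      rw [hS w, Matrix.mul_apply]
      simp only [Matrix.mul_diagonal, Matrix.conjTranspose_apply]
    refine ⟨u, d, fun w i => ?_, fun w i j hij => ?_, fun w i j hij => ?_, fun w hw i j => ?_,
      fun w k => ?_, fun w w' k => ?_, fun w i j hij => ?_, fun w => ?_⟩
    · -- unipotent
      obtain ⟨i₀, rfl⟩ | rfl := i.eq_castSucc_or_eq_last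
      · rw [hu_cc, hu'1]
      · exact hu_ll w
    · -- upper triangular
      obtain ⟨j₀, rfl⟩ | rfl := j.eq_castSucc_or_eq_last
      · obtain ⟨i₀, rfl⟩ | rfl := i.eq_castSucc_or_eq_last
        · rw [hu_cc, hu'0 w i₀ j₀ (Fin.castSucc_lt_castSucc_iff.mp hij)]
        · exact hu_lc w j₀
      · exact absurd hij (not_lt.mpr (Fin.le_last i))
    · -- off-diagonal bound
      obtain ⟨j₀, rfl⟩ | rfl := j.eq_castSucc_or_eq_last
      · obtain ⟨i₀, rfl⟩ | rfl := i.eq_castSucc_or_eq_last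
        · rw [hu_cc]
          exact hu'c w i₀ j₀ (Fin.castSucc_lt_castSucc_iff.mp hij)
        · exact absurd (hij.trans (Fin.castSucc_lt_last j₀)) (lt_irrefl _)
      · obtain ⟨i₀, rfl⟩ | rfl := i.eq_castSucc_or_eq_last
        · rw [hu_cl, hx_def]
          dsimp only
          rw [norm_div, ha w, Complex.norm_real, Real.norm_of_nonneg (hapos w).le,
            div_lt_iff₀ (hapos w)]
          exact hcol w i₀
        · exact absurd hij (lt_irrefl _)
    · -- realness
      obtain ⟨j₀, rfl⟩ | rfl := j.eq_castSucc_or_eq_last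
      · obtain ⟨i₀, rfl⟩ | rfl := i.eq_castSucc_or_eq_last
        · rw [hu_cc, hu'r w hw]
        · rw [hu_lc, map_zero]
      · obtain ⟨i₀, rfl⟩ | rfl := i.eq_castSucc_or_eq_last
        · rw [hu_cl, hx_def]
          dsimp only
          rw [map_div₀, hreal w hw, hreal w hw]
        · rw [hu_ll, map_one]
    · -- positivity
      obtain ⟨k₀, rfl⟩ | rfl := k.eq_castSucc_or_eq_last
      · rw [hd_c]; exact hd'pos w k₀
      · rw [hd_l]; exact hapos w
    · -- comparability across the index set
      obtain ⟨k₀, rfl⟩ | rfl := k.eq_castSucc_or_eq_last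
      · rw [hd_c, hd_c]; exact hd'cross w w' k₀
      · rw [hd_l, hd_l]; exact hcross w w'
    · -- successive ratios
      obtain ⟨j₀, rfl⟩ | rfl := j.eq_castSucc_or_eq_last
      · obtain ⟨i₀, rfl⟩ | rfl := i.eq_castSucc_or_eq_last
        · rw [hd_c, hd_c]
          exact hd'ratio w i₀ j₀ (by simpa using hij)
        · exact absurd hij (by simp; omega)
      · obtain ⟨i₀, rfl⟩ | rfl := i.eq_castSucc_or_eq_last
        · have hi₀ : (i₀ : ℕ) + 1 = m := by simpa using hij
          rw [hd_c, hd_l]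
          have h₁ := hratio w i₀ hi₀
          -- the Schur pivot is `λ'_{w,i₀}`: row `i₀` (the last index) of `u'_w` is `e_{i₀}`
          have h₂ : SiegelFamily.schur H w i₀ i₀ = (d' w i₀ : ℂ) := by
            rw [← hSe w i₀ i₀, Finset.sum_eq_single_of_mem i₀ (Finset.mem_univ _) fun k _ hk => ?_]
            · rw [hu'1, one_mul, star_one, mul_one]
            · have hk' : k < i₀ := Fin.lt_def.mpr (by have := k.isLt; omega)
              rw [hu'0 w i₀ k hk', zero_mul, zero_mul]
          rw [h₂, Complex.ofReal_re] at h₁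
          exact h₁
        · exact absurd hij (by simp)
    · -- the decomposition `H_w = u_w diag(λ_w) u_wᴴ`
      ext i j
      rw [Matrix.mul_apply]
      simp only [Matrix.mul_diagonal, Matrix.conjTranspose_apply, Fin.sum_univ_castSucc]
      obtain ⟨i₀, rfl⟩ | rfl := i.eq_castSucc_or_eq_last <;>
        obtain ⟨j₀, rfl⟩ | rfl := j.eq_castSucc_or_eq_last
      · -- top-left block: `S + a x xᴴ`
        simp only [hu_cc, hu_cl, hd_c, hd_l, hSe, SiegelFamily.schur_apply, hx_def]
        rw [star_div₀, (hh w).apply (Fin.last m) j₀.castSucc, ha w, hstar_a]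
        have hane : (a w : ℂ) ≠ 0 := Complex.ofReal_ne_zero.mpr (hapos w).ne'
        field_simp
        ring
      · -- last column: `a x`
        simp only [hu_cc, hu_cl, hu_lc, hu_ll, hd_c, hd_l, star_zero, mul_zero,
          Finset.sum_const_zero, zero_add, star_one, mul_one, hx_def]
        rw [ha w, div_mul_cancel₀ _ (Complex.ofReal_ne_zero.mpr (hapos w).ne')]
      · -- last row: `a xᴴ`
        simp only [hu_cl, hu_lc, hu_ll, hd_c, hd_l, zero_mul, Finset.sum_const_zero, zero_add,
          one_mul, hx_def]
        rw [star_div₀, (hh w).apply (Fin.last m) j₀.castSucc, ha w, hstar_a,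
          mul_div_cancel₀ _ (Complex.ofReal_ne_zero.mpr (hapos w).ne')]
      · -- the pivot
        simp only [hu_lc, hu_ll, hd_l, zero_mul, Finset.sum_const_zero, zero_add, one_mul, star_one,
          mul_one]
        exact ha w

end Cholesky

/-! ### 2. A compact archimedean piece of the Borel subgroup -/

section Omega

open scoped Classical in
/-- **`GL_n(K ⊗ ℝ) → M_n(K ⊗ ℝ)` is a topological embedding**: matrix inversion
`X ↦ (det X)⁻¹ • adj X` is continuous on the invertible matrices, since `Ring.inverse` is continuous
at the units of the complete normed ring `K ⊗ ℝ = ℝ^{r₁} × ℂ^{r₂}`. [folklore] -/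
theorem sandOut_isEmbedding_coe (n : ℕ) (K : Type) [Field K] [NumberField K] :
    Topology.IsEmbedding
      ((↑) : GL (Fin n) (mixedSpace K) → Matrix (Fin n) (Fin n) (mixedSpace K)) :=
  Units.isEmbedding_val_mk' (f := fun X : Matrix (Fin n) (Fin n) (mixedSpace K) => X⁻¹)
    (fun X hX => by
      obtain ⟨v, hv⟩ := (Matrix.isUnit_iff_isUnit_det X).mp hX
      exact (continuousAt_matrix_inv X (hv ▸ NormedRing.inverse_continuousAt v)).continuousWithinAt)
    fun g => (Matrix.coe_units_inv g).symm

/-- A set of invertible matrices over `K ⊗ ℝ` which is compact in `M_n(K ⊗ ℝ)` is compact in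
`GL_n(K ⊗ ℝ)`. [folklore] -/
theorem sandOut_isCompact_of_coe {n : ℕ} {K : Type} [Field K] [NumberField K]
    {S : Set (Matrix (Fin n) (Fin n) (mixedSpace K))}
    (hS : IsCompact S) (hU : ∀ X ∈ S, IsUnit X) :
    IsCompact {g : GL (Fin n) (mixedSpace K) |
      (g : Matrix (Fin n) (Fin n) (mixedSpace K)) ∈ S} := by
  refine (sandOut_isEmbedding_coe n K).isInducing.isCompact_iff.mpr ?_
  convert hS using 1
  ext X
  refine ⟨?_, fun hX => ?_⟩
  · rintro ⟨g, hg, rfl⟩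
    exact hg
  · obtain ⟨g, rfl⟩ := hU X hX
    exact ⟨g, hX, rfl⟩

open scoped Classical in
/-- **A compact archimedean piece of the Borel subgroup containing all bounded upper triangular
elements with diagonal bounded below**: for `N` and `ε > 0` there is `Ω ⊆ B(𝔸_K)` with trivial
finite part and compact closure containing `(g, 1)` for every `g ∈ GL_n(K ⊗ ℝ)` whose matrix is
upper triangular with entries of norm `≤ N` and diagonal entries with all components of real part
`≥ ε` (such matrices form a compact set of invertible matrices, `det = ∏` of the diagonal, and
`g ↦ (g, 1)` is continuous). [folklore] -/
theorem sandOut_exists_Omega (n : ℕ) (K : Type) [Field K] [NumberField K] (N ε : ℝ) (hε : 0 < ε) :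
    ∃ Ω : Set (GL (Fin n) (AdeleRing (𝓞 K) K)),
      Ω ⊆ (standardParabolicGL (AdeleRing (𝓞 K) K) (id : Fin n → Fin n) :
        Set (GL (Fin n) (AdeleRing (𝓞 K) K))) ∧
      Ω ⊆ Set.range (GLn.ofInfinite n K) ∧ IsCompact (closure Ω) ∧
      ∀ g : GL (Fin n) (mixedSpace K),
        (∀ i j, ‖(g : Matrix (Fin n) (Fin n) (mixedSpace K)) i j‖ ≤ N) →
        (g : Matrix (Fin n) (Fin n) (mixedSpace K)).BlockTriangular id →
        (∀ k w, ε ≤ ((g : Matrix (Fin n) (Fin n) (mixedSpace K)) k k).1 w) →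
        (∀ k w, ε ≤ (((g : Matrix (Fin n) (Fin n) (mixedSpace K)) k k).2 w).re) →
        GLn.ofInfinite n K g ∈ Ω := by
  set S : Set (Matrix (Fin n) (Fin n) (mixedSpace K)) :=
    {X | (∀ i j, ‖X i j‖ ≤ N) ∧ X.BlockTriangular id ∧ (∀ k w, ε ≤ (X k k).1 w) ∧
      ∀ k w, ε ≤ ((X k k).2 w).re} with hS_def
  -- `S` is compact: closed and inside a product of closed balls
  have helem : ∀ i j : Fin n, Continuous fun X : Matrix (Fin n) (Fin n) (mixedSpace K) => X i j :=
    fun i j => continuous_id.matrix_elem i j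
  have hSclosed : IsClosed S := by
    have h₁ : IsClosed {X : Matrix (Fin n) (Fin n) (mixedSpace K) | ∀ i j, ‖X i j‖ ≤ N} := by
      simp only [Set.setOf_forall]
      exact isClosed_iInter fun i => isClosed_iInter fun j =>
        isClosed_le (continuous_norm.comp (helem i j)) continuous_const
    have h₂ : IsClosed {X : Matrix (Fin n) (Fin n) (mixedSpace K) | X.BlockTriangular id} := by
      simp only [Matrix.BlockTriangular, Set.setOf_forall]
      exact isClosed_iInter fun i => isClosed_iInter fun j => isClosed_iInter fun _ =>
        isClosed_eq (helem i j) continuous_const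
    have h₃ : IsClosed {X : Matrix (Fin n) (Fin n) (mixedSpace K) | ∀ k w, ε ≤ (X k k).1 w} := by
      simp only [Set.setOf_forall]
      exact isClosed_iInter fun k => isClosed_iInter fun w => isClosed_le continuous_const
        ((continuous_apply w).comp (continuous_fst.comp (helem k k)))
    have h₄ : IsClosed {X : Matrix (Fin n) (Fin n) (mixedSpace K) |
        ∀ k w, ε ≤ ((X k k).2 w).re} := by
      simp only [Set.setOf_forall]
      exact isClosed_iInter fun k => isClosed_iInter fun w => isClosed_le continuous_const
        (Complex.continuous_re.comp ((continuous_apply w).comp (continuous_snd.comp (helem k k))))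
    rw [hS_def]
    simp only [Set.setOf_and]
    exact h₁.inter (h₂.inter (h₃.inter h₄))
  have hScpt : IsCompact S := by
    refine (isCompact_univ_pi fun _ : Fin n => isCompact_univ_pi fun _ : Fin n =>
      isCompact_closedBall (0 : mixedSpace K) N).of_isClosed_subset hSclosed fun X hX => ?_
    exact Set.mem_univ_pi.mpr fun i => Set.mem_univ_pi.mpr fun j =>
      mem_closedBall_zero_iff.mpr (hX.1 i j)
  -- `S` consists of invertible matrices
  have hSU : ∀ X ∈ S, IsUnit X := fun X hX => by
    rw [Matrix.isUnit_iff_isUnit_det, Matrix.det_of_upperTriangular hX.2.1, IsUnit.prod_univ_iff]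
    intro k
    refine isUnit_iff_exists_inv.mpr ⟨(fun w => ((X k k).1 w)⁻¹, fun w => ((X k k).2 w)⁻¹),
      Prod.ext (funext fun w => ?_) (funext fun w => ?_)⟩
    · show (X k k).1 w * ((X k k).1 w)⁻¹ = 1
      exact mul_inv_cancel₀ (hε.trans_le (hX.2.2.1 k w)).ne'
    · show (X k k).2 w * ((X k k).2 w)⁻¹ = 1
      refine mul_inv_cancel₀ fun h0 => ?_
      have h := hX.2.2.2 k w
      rw [h0, Complex.zero_re] at h
      exact absurd h (not_le.mpr hε)
  have h𝔅 := sandOut_isCompact_of_coe hScpt hSU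
  refine ⟨GLn.ofInfinite n K '' {g | (g : Matrix (Fin n) (Fin n) (mixedSpace K)) ∈ S}, ?_, ?_,
    (h𝔅.image (GLn.continuous_ofInfinite n K)).closure,
    fun g h₁ h₂ h₃ h₄ => ⟨g, ⟨h₁, h₂, h₃, h₄⟩, rfl⟩⟩
  · -- upper triangular, hence in `B(𝔸_K)`
    rintro _ ⟨g, hg, rfl⟩
    rw [SetLike.mem_coe, mem_standardParabolicGL_iff]
    intro i j hij
    have hij' : j ≠ i := ne_of_lt hij
    have h0 : (g : Matrix (Fin n) (Fin n) (mixedSpace K)) i j = 0 := hg.2.1 hij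
    rw [GLn.coe_ofInfinite_apply, h0, map_zero, Matrix.one_apply_ne' hij']
    rfl
  · rintro _ ⟨g, -, rfl⟩
    exact ⟨g, rfl⟩

end Omega

end Summit.Langlands.Langlands.Theorems.HeckeEigenvalueField.Res
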